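import Mathlib
import Literature.Probability.LatticeModels.GKSInequalities
import Literature.Probability.LatticeModels.IsingInverseMCertificate
import HarnessLib

/-!
# Soundness of the inverse-M certificate checker `IsingPolynomial.check`

For a finite graph `(Fin n, E)` with the same coupling `K ≥ 0` on every edge, a certificate accepted
by `IsingPolynomial.check n E Mtab Bcls Bidx d` proves that every off-diagonal entry of the inverse
of the spin second-moment matrix `Σ_{pq} = ⟨σ_pσ_q⟩` (the system `gksExpect univ (fun _ => K)
(edgeSet n E)`, Friedli–Velenik 2017 §3.8.1) is `≤ 0` (`inv_entry_nonpos_of_check`).  The chain: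
`e^{Ks} = e^{-K}(1 + ((1+s)/2)(e^{2K}-1))` for `s = ±1`, so `Z·Σ = e^{-|E|K} M(v)`, `v = e^{2K}-1 ≥ 0`,
with `M` the Edwards–Sokal matrix computed by `IsingPolynomial.entry` (enumeration of `{±1}^n` coded
by `k < 2^n`, transported along `SpinConfig (Fin n) ≃ Fin (2^n)`); the checked identity
`M(v)B(v) = d(v)·1` with `d(v) > 0` gives `M(v)⁻¹ = d(v)⁻¹B(v)`, hence
`Σ⁻¹ = (Z e^{|E|K}/d(v)) B(v)` entrywise, and the off-diagonal entries of `B(v)` are `≤ 0` because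
their coefficients are. [cite: FriedliVelenik2017, §3.8.1]
-/

namespace Literature.Probability.LatticeModels

namespace IsingPolynomial

open Finset Matrix

/-! ### Spin configurations coded by naturals -/

/-- The decoded configuration has spin `spinOf k p` at site `p`. [folklore] -/
theorem coe_cfgEquiv_symm (n : ℕ) (k : Fin (2 ^ n)) (p : Fin n) :
    (((cfgEquiv n).symm k p : ℤˣ) : ℤ) = spinOf k p := by
  have h1 : (cfgEquiv n).symm k p = unitsEquivFin2.symm (finFunctionFinEquiv.symm k p) := rfl
  have h2 : ((finFunctionFinEquiv.symm k p : Fin 2) : ℕ) = k / 2 ^ (p : ℕ) % 2 :=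
    finFunctionFinEquiv_symm_apply_val k p
  rw [h1]
  simp only [unitsEquivFin2, Equiv.coe_fn_symm_mk, spinOf]
  have h3 : finFunctionFinEquiv.symm k p = 1 ↔ bit k p = 1 := by
    rw [Fin.ext_iff, h2, Fin.val_one, bit]
  by_cases hc : bit k p = 1
  · rw [if_pos (h3.2 hc), if_pos hc]; simp
  · rw [if_neg (mt h3.1 hc), if_neg hc]; simp

/-- In range, `spinN` of a decoded configuration is `spinOf`. [folklore] -/
theorem spinN_cfgEquiv_symm {n : ℕ} (k : Fin (2 ^ n)) {a : ℕ} (ha : a < n) :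
    spinN ((cfgEquiv n).symm k) a = spinOf k a := by
  rw [spinN, dif_pos ha, coe_cfgEquiv_symm]

/-- On a decoded configuration the two satisfied-edge counts agree. [folklore] -/
theorem satCountR_cfgEquiv_symm {n : ℕ} (k : Fin (2 ^ n)) (l : List (ℕ × ℕ))
    (hl : ∀ e ∈ l, e.1 < n ∧ e.2 < n) : satCountR ((cfgEquiv n).symm k) l = satCount k l := by
  induction l with
  | nil => rfl
  | cons e es ih =>
    have he := hl e (by simp)
    have ih' := ih fun e' he' => hl e' (by simp [he'])
    have hiff : spinN ((cfgEquiv n).symm k) e.1 = spinN ((cfgEquiv n).symm k) e.2 ↔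
        bit k e.1 = bit k e.2 := by
      rw [spinN_cfgEquiv_symm k he.1, spinN_cfgEquiv_symm k he.2, spinOf, spinOf]
      have h1 : bit k e.1 < 2 := Nat.mod_lt _ (by norm_num)
      have h2 : bit k e.2 < 2 := Nat.mod_lt _ (by norm_num)
      have key : ∀ x, x < 2 → ∀ y, y < 2 →
          (((if x = 1 then (1 : ℤ) else -1) = if y = 1 then (1 : ℤ) else -1) ↔ x = y) := by decide
      exact key _ h1 _ h2
    simp only [satCountR, satCount, ih']
    by_cases h : bit k e.1 = bit k e.2
    · rw [if_pos (hiff.2 h), if_pos h]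
    · rw [if_neg (mt hiff.1 h), if_neg h]

/-! ### The Boltzmann factors in the variable `v = e^{2K} - 1` -/

/-- A well-formed edge list has endpoints below `n` and no loops (indexed form). [folklore] -/
theorem edgesOK_get {n : ℕ} {E : List (ℕ × ℕ)} (hE : edgesOK n E = true) (i : Fin E.length) :
    (E[i.1]).1 < n ∧ (E[i.1]).2 < n ∧ (E[i.1]).1 ≠ (E[i.1]).2 := by
  simp only [edgesOK, List.all_eq_true, Bool.and_eq_true, decide_eq_true_eq, Bool.not_eq_true',
    beq_eq_false_iff_ne, ne_eq] at hE
  obtain ⟨⟨h1, h2⟩, h3⟩ := hE _ (List.getElem_mem i.2)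
  exact ⟨h1, h2, h3⟩

/-- A well-formed edge list has endpoints below `n` (membership form). [folklore] -/
theorem edgesOK_mem {n : ℕ} {E : List (ℕ × ℕ)} (hE : edgesOK n E = true) :
    ∀ e ∈ E, e.1 < n ∧ e.2 < n := by
  simp only [edgesOK, List.all_eq_true, Bool.and_eq_true, decide_eq_true_eq] at hE
  exact fun e he => ⟨(hE e he).1.1, (hE e he).1.2⟩

/-- `edgeSet n E i` is the two-element set of the endpoints of edge `i`. [folklore] -/
theorem edgeSet_eq {n : ℕ} {E : List (ℕ × ℕ)} (hE : edgesOK n E = true) (i : Fin E.length) :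
    edgeSet n E i = {⟨(E[i.1]).1, (edgesOK_get hE i).1⟩, ⟨(E[i.1]).2, (edgesOK_get hE i).2.1⟩} := by
  ext z
  simp [edgeSet, Fin.ext_iff]

/-- The interactions attached to a well-formed edge list are pairs. [folklore] -/
theorem card_edgeSet {n : ℕ} {E : List (ℕ × ℕ)} (hE : edgesOK n E = true) (i : Fin E.length) :
    (edgeSet n E i).card = 2 := by
  rw [edgeSet_eq hE i, Finset.card_pair]
  exact fun h => (edgesOK_get hE i).2.2 (Fin.mk.inj_iff.1 h)

/-- One Edwards–Sokal factor: `1 + ((1 + σ_aσ_b)/2)·v` is `1 + v` if `σ_a = σ_b` and `1` otherwise. [folklore] -/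
theorem factor_eq {n : ℕ} {E : List (ℕ × ℕ)} (hE : edgesOK n E = true) (ω : SpinConfig (Fin n))
    (v : ℝ) (i : Fin E.length) :
    1 + (1 + spinProduct (edgeSet n E i) ω) / 2 * v =
      if spinN ω (E[i.1]).1 = spinN ω (E[i.1]).2 then 1 + v else 1 := by
  obtain ⟨ha, hb, hab⟩ := edgesOK_get hE i
  have hne : (⟨(E[i.1]).1, ha⟩ : Fin n) ≠ ⟨(E[i.1]).2, hb⟩ := fun h => hab (Fin.mk.inj_iff.1 h)
  rw [edgeSet_eq hE i, spinProduct, Finset.prod_pair hne, spinN, dif_pos ha, spinN, dif_pos hb]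
  simp only [spinAt]
  rcases Int.units_eq_one_or (ω ⟨(E[i.1]).1, ha⟩) with h1 | h1 <;>
    rcases Int.units_eq_one_or (ω ⟨(E[i.1]).2, hb⟩) with h2 | h2 <;>
    simp [h1, h2]

/-- The product of the Edwards–Sokal factors along a list is `(1+v)^{#satisfied}`. [folklore] -/
theorem prod_map_factor {n : ℕ} (ω : SpinConfig (Fin n)) (v : ℝ) (l : List (ℕ × ℕ)) :
    (l.map fun e => if spinN ω e.1 = spinN ω e.2 then 1 + v else (1 : ℝ)).prod =
      (1 + v) ^ satCountR ω l := by
  induction l with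
  | nil => simp [satCountR]
  | cons e es ih =>
    simp only [List.map_cons, List.prod_cons, ih, satCountR]
    split_ifs <;> ring

/-- The Edwards–Sokal product is `(1+v)^{sat(ω)}`. [folklore] -/
theorem prod_factor_eq {n : ℕ} {E : List (ℕ × ℕ)} (hE : edgesOK n E = true) (ω : SpinConfig (Fin n))
    (v : ℝ) : ∏ i : Fin E.length, (1 + (1 + spinProduct (edgeSet n E i) ω) / 2 * v) =
      (1 + v) ^ satCountR ω E := by
  simp_rw [factor_eq hE ω v]
  rw [Fin.prod_univ_fun_getElem E fun e => if spinN ω e.1 = spinN ω e.2 then 1 + v else (1 : ℝ)]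
  exact prod_map_factor ω v E

/-! ### Evaluation of the enumeration -/

/-- `cfgSum f d k` evaluates to `∑_{j<2^d} f(2^d k + j)` evaluated. [folklore] -/
theorem leval_cfgSum (v : ℝ) (f : ℕ → List ℤ) (d k : ℕ) :
    leval (cfgSum f d k) v = ∑ j ∈ Finset.range (2 ^ d), leval (f (2 ^ d * k + j)) v := by
  induction d generalizing k with
  | zero => simp [cfgSum]
  | succ d ih =>
    rw [cfgSum, leval_ladd, ih, ih]
    have h2 : 2 ^ (d + 1) = 2 ^ d + 2 ^ d := by ring
    rw [h2, Finset.sum_range_add]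
    congr 1
    · exact Finset.sum_congr rfl fun j _ => by
        rw [show 2 ^ d * (2 * k) + j = (2 ^ d + 2 ^ d) * k + j by ring]
    · exact Finset.sum_congr rfl fun j _ => by
        rw [show 2 ^ d * (2 * k + 1) + j = (2 ^ d + 2 ^ d) * k + (2 ^ d + j) by ring]

/-- Evaluation of one configuration term. [folklore] -/
theorem leval_term (v : ℝ) (E : List (ℕ × ℕ)) (p q k : ℕ) :
    leval (term E p q k) v = ((spinOf k p * spinOf k q : ℤ) : ℝ) * (1 + v) ^ satCount k E := by
  rw [term, leval_lsmul, leval_onePlusPow]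

/-- **The enumeration is correct**: the Edwards–Sokal sum over genuine spin configurations equals the
value of the computed coefficient list `entry n E p q`. [folklore] -/
theorem esSum_eq_leval_entry {n : ℕ} {E : List (ℕ × ℕ)} (hE : edgesOK n E = true) (v : ℝ)
    (p q : Fin n) :
    ∑ ω : SpinConfig (Fin n), spinAt p ω * spinAt q ω *
        ∏ i : Fin E.length, (1 + (1 + spinProduct (edgeSet n E i) ω) / 2 * v) =
      leval (entry n E p q) v := by
  simp_rw [prod_factor_eq hE]
  rw [← Equiv.sum_comp (cfgEquiv n).symm, entry, leval_cfgSum]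
  simp only [mul_zero, zero_add]
  rw [← Fin.sum_univ_eq_sum_range (fun k => leval (term E p q k) v) (2 ^ n)]
  refine Finset.sum_congr rfl fun k _ => ?_
  rw [leval_term, satCountR_cfgEquiv_symm k E (edgesOK_mem hE), spinAt, spinAt,
    coe_cfgEquiv_symm, coe_cfgEquiv_symm]
  push_cast
  ring

/-- **The unnormalised pair sum is `e^{-|E|K}` times the Edwards–Sokal polynomial at `e^{2K}-1`.** [folklore] -/
theorem gksSum_pair_eq {n : ℕ} {E : List (ℕ × ℕ)} (hE : edgesOK n E = true) (K : ℝ) (p q : Fin n) :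
    gksSum Finset.univ (fun _ : Fin E.length => K) (edgeSet n E) (fun ω => spinAt p ω * spinAt q ω) =
      Real.exp (-K) ^ E.length * leval (entry n E p q) (Real.exp (2 * K) - 1) := by
  rw [← esSum_eq_leval_entry hE, gksSum, Finset.mul_sum]
  refine Finset.sum_congr rfl fun ω _ => ?_
  have hw : gksWeight Finset.univ (fun _ : Fin E.length => K) (edgeSet n E) ω =
      Real.exp (-K) ^ E.length *
        ∏ i : Fin E.length, (1 + (1 + spinProduct (edgeSet n E i) ω) / 2 * (Real.exp (2 * K) - 1)) := by
    rw [gksWeight, gksHamiltonian, Real.exp_sum, ← Fin.prod_const, ← Finset.prod_mul_distrib]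
    refine Finset.prod_congr rfl fun i _ => ?_
    -- one Boltzmann factor in the variable `v`: `e^{Ks} = e^{-K}(1 + ((1+s)/2)(e^{2K}-1))`, `s = ±1`
    rcases spinProduct_eq_one_or (edgeSet n E i) ω with hs | hs <;> rw [hs]
    · have h : Real.exp (-K) * Real.exp (2 * K) = Real.exp (K * 1) := by
        rw [← Real.exp_add]; congr 1; ring
      rw [← h]; ring
    · rw [show K * -1 = -K by ring]; ring
  rw [hw]; ring

/-! ### Soundness -/

/-- `List.range` sums are `Finset.range` sums. [folklore] -/
theorem list_sum_range_eq (f : ℕ → ℝ) (n : ℕ) :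
    ((List.range n).map f).sum = ∑ r ∈ Finset.range n, f r := by
  induction n with
  | zero => simp
  | succ n ih => rw [List.range_succ, List.map_append, List.sum_append, ih, Finset.sum_range_succ]; simp

/-- Extract a pointwise fact from `(List.range n).all`. [folklore] -/
theorem all_range {n : ℕ} {f : ℕ → Bool} (h : (List.range n).all f = true) {p : ℕ} (hp : p < n) :
    f p = true :=
  List.all_eq_true.1 h p (List.mem_range.2 hp)

/-- **From a verified identity to the sign of the inverse.**  If `M(v) B = d·1` for the TRUE
Edwards–Sokal matrix `M(v)_{pq} = leval (entry n E p q) v` at `v = e^{2K}-1`, with `d > 0` and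
`B_{xy} ≤ 0`, then `(Σ⁻¹)_{xy} ≤ 0` for the uniform-coupling system on `(Fin n, E)`:
`Σ = (Z⁻¹ e^{-|E|K}) M(v)`, so `Σ⁻¹ = (Z e^{|E|K} / d) B`. (Shared by all certificate formats.) [folklore] -/
theorem inv_entry_nonpos_of_mul_eq {n : ℕ} {E : List (ℕ × ℕ)} (hE : edgesOK n E = true) (K : ℝ)
    (Bv : Matrix (Fin n) (Fin n) ℝ) (dv : ℝ) (hd : 0 < dv)
    (hMB : (Matrix.of fun p q : Fin n => leval (entry n E p q) (Real.exp (2 * K) - 1)) * Bv =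
      dv • (1 : Matrix (Fin n) (Fin n) ℝ))
    (x y : Fin n) (hB : Bv x y ≤ 0) :
    (Matrix.of fun p q : Fin n => gksExpect Finset.univ (fun _ : Fin E.length => K) (edgeSet n E)
        (fun ω => spinAt p ω * spinAt q ω))⁻¹ x y ≤ 0 := by
  set v : ℝ := Real.exp (2 * K) - 1 with hv_def
  set c : ℝ := Real.exp (-K) ^ E.length with hc_def
  have hc : 0 < c := pow_pos (Real.exp_pos _) _
  set Z : ℝ := gksSum Finset.univ (fun _ : Fin E.length => K) (edgeSet n E) (fun _ => 1) with hZ_def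
  have hZ : 0 < Z := gksSum_one_pos _ _ _
  set Mv : Matrix (Fin n) (Fin n) ℝ := Matrix.of fun p q : Fin n => leval (entry n E p q) v with hMv
  -- the second-moment matrix is a positive multiple of `Mv`
  have hG : (Matrix.of fun p q : Fin n => gksExpect Finset.univ (fun _ : Fin E.length => K)
      (edgeSet n E) (fun ω => spinAt p ω * spinAt q ω)) = (Z⁻¹ * c) • Mv := by
    ext p q
    simp only [Matrix.of_apply, Matrix.smul_apply, smul_eq_mul, hMv, gksExpect]
    rw [gksSum_pair_eq hE K p q, ← hZ_def, div_eq_inv_mul]; ring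
  have hinv : ((Z⁻¹ * c) • Mv)⁻¹ = ((Z⁻¹ * c)⁻¹ * dv⁻¹) • Bv := by
    apply Matrix.inv_eq_right_inv
    rw [Matrix.smul_mul, Matrix.mul_smul, hMB, smul_smul, smul_smul]
    rw [show Z⁻¹ * c * ((Z⁻¹ * c)⁻¹ * dv⁻¹) * dv = 1 by field_simp]
    exact one_smul _ _
  rw [hG, hinv, Matrix.smul_apply, smul_eq_mul]
  exact mul_nonpos_of_nonneg_of_nonpos (by positivity) hB

/-- **Soundness of the certificate checker.**  If `check n E Mtab Bcls Bidx d` accepts, then for every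
coupling `K ≥ 0` every off-diagonal entry of the inverse of the spin second-moment matrix of the
uniform-coupling zero-field Ising model on `(Fin n, E)` is `≤ 0`. [folklore] -/
theorem inv_entry_nonpos_of_check {n : ℕ} {E : List (ℕ × ℕ)} {Mtab : List (List (List ℤ))}
    {Bcls : List (List ℤ)} {Bidx : List (List ℕ)} {d : List ℤ}
    (h : check n E Mtab Bcls Bidx d = true) (K : ℝ) (hK : 0 ≤ K) (x y : Fin n) (hxy : x ≠ y) :
    (Matrix.of fun p q : Fin n => gksExpect Finset.univ (fun _ : Fin E.length => K) (edgeSet n E)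
        (fun ω => spinAt p ω * spinAt q ω))⁻¹ x y ≤ 0 := by
  simp only [check, Bool.and_eq_true] at h
  obtain ⟨⟨⟨⟨hE, hM⟩, hP⟩, ⟨hd, hd0⟩⟩, hB⟩ := h
  set v : ℝ := Real.exp (2 * K) - 1 with hv_def
  have hv : 0 ≤ v := sub_nonneg.2 (Real.one_le_exp (by linarith))
  set Bv : Matrix (Fin n) (Fin n) ℝ := Matrix.of fun p q : Fin n => leval (getB Bcls Bidx p q) v
    with hBv
  have hdpos : 0 < leval d v := leval_pos hd hd0 hv
  -- the checked identity `M B = d 1`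
  have hMB : (Matrix.of fun p q : Fin n => leval (entry n E p q) v) * Bv =
      leval d v • (1 : Matrix (Fin n) (Fin n) ℝ) := by
    ext p q
    have hpq := all_range (all_range hP p.2) q.2
    have key := leval_eq_of_lEq v hpq
    rw [prodEntry, leval_lsum, List.map_map] at key
    have hsum : ∑ r : Fin n, leval (entry n E p r) v * leval (getB Bcls Bidx r q) v =
        leval (if (p : ℕ) = q then d else []) v := by
      rw [← key, Fin.sum_univ_eq_sum_range
        (fun r => leval (entry n E p r) v * leval (getB Bcls Bidx r q) v) n, ← list_sum_range_eq]
      congr 1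
      refine List.map_congr_left fun r hr => ?_
      simp only [Function.comp, leval_lmul]
      rw [leval_eq_of_lEq v (all_range (all_range hM p.2) (List.mem_range.1 hr))]
    simp only [hBv, Matrix.mul_apply, Matrix.of_apply, Matrix.smul_apply, Matrix.one_apply,
      smul_eq_mul, mul_ite, mul_one, mul_zero]
    rw [hsum]
    by_cases hpq' : p = q
    · subst hpq'; simp
    · rw [if_neg (fun h' => hpq' (Fin.ext h')), if_neg hpq']; simp
  refine inv_entry_nonpos_of_mul_eq hE K Bv (leval d v) hdpos hMB x y ?_
  have hBxy := all_range (all_range hB x.2) y.2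
  simp only [Bool.or_eq_true, beq_iff_eq] at hBxy
  rcases hBxy with hxy' | hnp
  · exact absurd (Fin.ext hxy') hxy
  · simpa [hBv] using leval_nonpos hnp hv

end IsingPolynomial

end Literature.Probability.LatticeModels
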